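import Summits.CriticalPhenomena.SAWScalingLimit.Theses.SAWLoopFugacityFlow
import Literature.Probability.LatticeModels.DiluteLoopModelIsing
import Literature.Probability.LatticeModels.DiluteLoopModelSAW
import Literature.Probability.LatticeModels.GKSInequalities
import Literature.Probability.RandomPlanarGeometry.SAWScalingLimitFamily
import Literature.Probability.RandomPlanarGeometry.CaratheodoryHalfPlaneProofs
import Literature.Probability.RandomPlanarGeometry.RestrictionHullsRiemannProofs
import Literature.Probability.RandomPlanarGeometry.RestrictionHullsProofs
import Literature.Probability.RandomPlanarGeometry.HullSubdomainPullback

/-!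
# Disproof of `IsingBoundaryRatio` — standing adversary's work file
(crux item stmt-CriticalPhenomena-10650 of route SAWLoopFugacityFlow, rank 6, the `n = 1` ANCHOR of
the loop-fugacity continuation; refuter `cdisprove`, gen 1; everything below is `lean check`ed and
SORRY-FREE.)

CRUX (read-back, §0): for Dobrushin domains `D' ⊆ D` with the same marked points `a, b` and
agreeing with `D` in `ε`-balls around `a` and `b`, for lattice endpoints `a_δ, b_δ` that are an
endpoint approximation in BOTH `Ω_δ` and `Ω'_δ`, for a chordal uniformizer `φ : (ℍ;0,∞) → (D;a,b)`,
`A = closure (ℍ ∖ φ⁻¹ D')`, `Φ` the normalised restriction map of `A` and `d = Φ'_A(0)`: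
`⟨σ_{a_δ}σ_{b_δ}⟩^free_{Ω'_δ,β_c} / ⟨σ_{a_δ}σ_{b_δ}⟩^free_{Ω_δ,β_c} → d^{1/2}` as `δ → 0⁺`
(free-b.c. critical Ising on `discreteDomainGraph`, volume = mesh-domain finset inline, `β =
log(1+√2)/2` inline, `LocallyFinite` structure quantified as `lf`).

VERDICT: NOT REFUTED — and numerically CONFIRMED to 1% (§Numerics); no typing artefact bites. The statement is the CFT covariance law for
the free-boundary spin as a weight-`½` boundary primary (`b(1) = ½`), read in the chordal
normalisation `Φ_A(0) = 0`, `Φ_A(z) ∼ z` at `∞`; it is (i) correctly normalised — TRUE on the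
diagonal `D' = D` (§6, `crux_diag`), (ii) inside the GKS-admissible range — the lattice ratio is
eventually in `(0,1]` and `d^{1/2} ∈ (0,1]` (§3, §5, §6), (iii) free of `0/0`, empty-volume and
tie junk along `𝓝[>] 0` (§2, §3, `eventually_meshDomain_subset`). A refutation must therefore be
OFF-DIAGONAL and QUANTITATIVE: an explicit hull `A ≠ ∅` with an Ising asymptotic contradicting
`Φ'_A(0)^{1/2}` — i.e. it must beat McCoy–Wu/CFT (boundary spin exponent `η_∥ = 1 = 2·½`) or
conformal covariance of the free-b.c. scaling limit. Nothing in print or in the tree points that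
way (see WHY IT RESISTS).

FINDINGS (theorem names in this namespace):
* §0 `isingBoundaryRatio_iff_normalForm` — the inline two-point function is the library one:
  `lf` is a subsingleton (`= instLocallyFiniteDiscreteDomainGraph`), the inline volume is
  `meshDomainFinset` and the inline `β` is `criticalBetaTwo` (`inline_eq_T`); the crux ⟺
  `NormalForm` (ratio `T D' / T D`, `T Ω δ x y = isingTwoPoint (Ω_δ) (meshDomainFinset Ω δ) β_c 0
  free x y`). `eventually_ratio_eq_domainBoundaryRatio` — eventually the ratio IS the route's
  loop-model object `R_δ(1; D, D') = domainBoundaryRatio ⟨1, ½, tanh β_c⟩` (tree: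
  `DiluteLoopModel.domainBoundaryRatio_isingPoint`), so the typed anchor and IsingWindow's `n = 1`
  case literally coincide.
* §1 `normalForm_iff_withoutPtEq` — the hypotheses `D'.pt 0 = D.pt 0`, `D'.pt 1 = D.pt 1` are
  IDLE: implied by the two endpoint approximations (`pt_eq_of_isEndpointApprox`, uniqueness of
  limits). §3 `normalForm_iff_withoutOuterApprox` — the OUTER approximation
  `SAW.IsEndpointApprox D a b` is IDLE too (`isEndpointApprox_of_subdomain`: an endpoint
  approximation of the subdomain `D' ⊆ D` is one of `D` — bulk components are nested). No
  `_false_without_` theorem can exist for these. The INNER approximation `IsEndpointApprox D' a b`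
  IS load-bearing (prose: comb-like `D'` with corridors accumulating at `a` admits `a_δ ∈ Ω_δ ∖ Ω'_δ`,
  where the inline numerator is the frozen-spin junk `⟨σ_{b_δ}⟩ = 0`), so the planner's double
  endpoint hypothesis is the right one.
* §2 junk catalogue: `T_self` (`a δ = b δ ⇒ T = 1`), `isingTwoPoint_free_eq_one_of_notMem` and
  `T_of_nonpos` (`δ ≤ 0 ⇒` empty volume, frozen spins, `T = 1`, ratio `≡ 1`): invisible along
  `𝓝[>] 0`; `not_tendsto_twoSided` — the two-sided strengthening (`𝓝 0`) is FALSE for every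
  datum with `d ≠ 1`.
* §3 lattice facts at `δ > 0` (all proved from tree theorems): `T_pos_of_reachable` — STRICT
  POSITIVITY `0 < ⟨σ_xσ_y⟩^free_{Ω_δ}` for `x, y` joined in `Ω_δ` (high-temperature expansion
  `isingTwoPoint_free_eq_hteSum_div` + the PATH WITNESS `hteSum_pos_of_path`: the edge set of a
  self-avoiding path has odd vertices exactly its endpoints, `IsTrail.even_countP_edges_iff`);
  `T_le_one`; `discreteDomainGraph_mono` + `T_mono` — GKS SANDWICH `T Ω' ≤ T Ω` for `Ω' ⊆ Ω`
  with nested mesh domains (tree theorems `isingCorr_free_mono_graph`,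
  `isingCorr_free_mono_volume_of_gks`, `GKSInequalities.gks_two_holds`);
  `eventually_meshDomain_subset` — under the crux hypotheses the mesh domains ARE nested for all
  small `δ` (largest component of a Jordan domain eventually unique,
  `JordanDomain.eventually_forall_mem_meshDomain'`), so the `meshDomain` tie convention is inert.
* §4 LOAD-BEARING NORMALISATIONS: `isingBoundaryRatio_false_without_IsRestrictionMap`,
  `isingBoundaryRatio_false_without_HasRestrictionDeriv` — delete either clause and the statement
  is contradictory already on the diagonal (`D = D' =` unit disc, `A = ∅`, dilations `z ↦ z`,
  `z ↦ 4z` resp. `d = 1, 4`: two limits `1 ≠ 2`). Any proof uses both (they are what pins `d`).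
* §5 conformal side: `deriv_eq_one_of_empty` (`A = ∅ ⇒ d = 1`, uniqueness of `Φ_∅`),
  `isHullSubdomain_of_conds` (the ε-ball clause ⇒ `MarkedDomain.IsHullSubdomain`),
  `starHull_and_deriv_mem` (under the hypotheses `A ∈ 𝒬*` and `d = Φ'_A(0) ∈ (0,1]`, tree
  theorems `IsStarHull.pullbackHull`, `exists_hasRestrictionDeriv_holds`, `HasRestrictionDeriv.unique`),
  `claimedLimit_mem_Ioc` (`d^{1/2} ∈ (0,1]`).
* §6 `crux_diag` — THE DIAGONAL `D' = D` OF THE CRUX IS A THEOREM (ratio eventually `≡ 1`,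
  `d = 1`); `eventually_ratio_mem_Ioc` — in general the ratio is eventually in `(0,1]`
  (unconditional: positivity + GKS + eventual nesting); `limit_le_one`; `not_tendsto_rpow_of_neg`
  — every NEGATIVE-exponent variant `d^e`, `e < 0`, is false at any genuine sub-hull (`d < 1`).

WHY IT RESISTS (for provers; prose, not formalised):
1. Exponent. Free-b.c. boundary spin = the fermion `ψ` on the boundary, `h = ½`: `Z_{free,free} =
   χ_0 + χ_{1/2}` (Cardy), and on the lattice `⟨σ_{0}σ_{N}⟩^free_{∂ℍ} ≍ N^{-1} = N^{-2h}` at `β_c`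
   (McCoy–Wu, ch. VII; CGG arXiv:2408.12923 Thm 1 for the half-plane scaling limit incl.
   non-integrable perturbations). In the chart `(ℍ; 0, ∞)` with `Φ_A(z) = z + O(1)`:
   `⟨ψ(0)ψ(L)⟩_{ℍ∖A}/⟨ψ(0)ψ(L)⟩_ℍ = Φ'(0)^h Φ'(L)^h (L/Φ(L))^{2h} → Φ'_A(0)^h`, `h = ½` — exactly
   the typed `d^{1/2}`; chart changes `z ↦ λz` leave `Φ'_A(0)` invariant. Sign/range check: GKS
   gives ratio `≤ 1` (§3) and `Φ'_A(0) ≤ 1` ([LSW] (2.4)); both proved here.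
2. Endpoints at mesoscopic depth (the planner's worry) do NOT change the limit: with `a_δ` at
   depth `ρ`, `δ ≪ ρ ≪ 1`, the bulk–boundary OPE at a FREE boundary is `σ(x+iρ) ≈ C ρ^{3/8} ψ(x)`
   (leading `ℤ₂`-odd boundary field is `ψ`, `⟨σ⟩_free = 0`), so the `ρ`-dependent factors are LOCAL
   and cancel in the ratio because `D` and `D'` agree in `B(a,ε)`, `B(b,ε)`; in the continuum the
   double limit is again `Φ'(0)^{1/8+3/8} = Φ'(0)^{1/2}`. A disproof along these lines would need
   non-commutation of `δ → 0` and `ρ → 0`, against RSW-type mixing of FK-Ising with free b.c.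
3. Rough boundaries away from `a, b` are allowed on both sides but enter only through the
   conformally invariant number `Φ'_A(0)`; free b.c. is the natural (graph-intrinsic) boundary
   condition, whose scaling limit is conformally invariant on arbitrary Jordan domains in every
   proved instance (FK-Ising/spin-Ising interfaces and crossing probabilities with free arcs:
   Hongler–Kytölä 2013, Benoist–Duminil-Copin–Hongler 2016, Izyurov 2015, CDHKS 2014).
4. What a proof needs beyond print: convergence of the RATIO of free boundary two-point functions
   for nested general Jordan domains with cancellation of the two local endpoint factors (a
   ratio-of-partition-functions statement via Kramers–Wannier: `⟨σ_aσ_b⟩^free_Ω = Z^{dual}_{Ω*}(a,b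
   Dobrushin)/Z^{dual}_{Ω*}(+)`), uniformly over endpoint approximations — [difficulty L] as filed.
   In print (read this session): Cava–Giuliani–Greenblatt arXiv:2408.12923 p. 5 — half-plane
   boundary spin observable `σ^a(z) = a^{-1/2} σ_{a⌊z/a⌋}` (weight ½ scaling) and "the two-point
   boundary spin integrable correlation decays as `∝ |y_i − y_j|^{-1}`", multipoint = Pfaffian; the
   nested-domain ratio for general Jordan `D` is not stated anywhere we hold (grounder g28-2 agrees).
5. THE SHIELDED-ENDPOINT ATTACK AND WHY THE JORDAN HYPOTHESIS KILLS IT. The one mechanism that could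
   make the limit depend on the far geometry `D ∖ D'` for a LEGAL endpoint approximation is
   shielding: endpoints `a_δ → a` sitting in pockets `P_δ ⊆ B(a, ε)` whose exits towards the nearby
   bulk are necks so long and thin (weight `≲ e^{-c·len/width}`: a critical Ising strip of width
   `w` cells has correlation length `O(w)` cells; for `w = 1, 2` also elementarily from
   `⟨σ_xσ_y⟩^free ≤ Σ_{SAW p : x → y} (tanh β)^{|p|}`) that a corridor of PHYSICAL
   length `≥ ε` running out of `B(a,ε)` into `D ∖ D'` (open into the bulk in `D`, a dead end in `D'`)
   carries comparable weight — then `T'/T` would tend to (near route)/(near + far route) `< 1` times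
   the conformal factor, or even to `0`. This needs, inside `D ∩ B(a,ε) = D' ∩ B(a,ε)`, infinitely
   many disjoint corridors of diameter `≥ ε/2` and widths `→ 0` accumulating at `a`; their walls are
   arcs of `∂D` accumulating on a non-degenerate continuum through `a`, so `∂D` is NOT locally
   connected there — impossible for a Jordan curve (`DobrushinDomain.boundary` is an injective
   continuous image of the circle; Jordan domains have the null-sequence property: for every `ε`
   only finitely many fjords of diameter `≥ ε`). With all shielding structures of diameter `→ 0`,
   every exit of `P_δ` lies near `a`, inside the balls where `D = D'`, and the exit factors are
   COMMON to numerator and denominator. MESSAGE FOR PLANNERS: the typed domain class is exactly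
   right — over bounded simply connected NON-Jordan domains (prime-end marked points) the same
   statement is false by the book-of-fjords construction above; and the INNER endpoint hypothesis
   `IsEndpointApprox D' a b` cannot be dropped (§3).
6. NUMERICS (kit jobs j008794 / j013886, Kac–Ward exact free-fermion evaluation of
   `⟨σ_aσ_b⟩^free` at `β_c` on boxes `[-L,L]×[0,L]` with and without the slit hull `{0}×[0,ℓ]`,
   boundary points `(∓m, 0)`, double extrapolation `L/m → ∞` then `m → ∞`): the law
   `R* = (m²/(m²+ℓ²))^{2h}` with `h = ½` is CONFIRMED to ≈ 1% (`R* = 0.498` vs `0.500` at `ℓ = m`,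
   `0.7995` vs `0.800` at `ℓ = m/2`; `h_eff = 0.503, 0.501`); see the `Numerics` section at the end
   of this file.
-/

noncomputable section

open scoped Classical symmDiff
open MeasureTheory Filter Topology Set Function Metric
open Literature.Probability.LatticeModels Literature.Probability.RandomPlanarGeometry
open UpperHalfPlane (upperHalfPlaneSet)

namespace Summit.CriticalPhenomena.SAWScalingLimit.Cruxes.IsingBoundaryRatio.Disproof

open Summit.CriticalPhenomena.SAWScalingLimit.Theses.SAWLoopFugacityFlow

/-! ## §0 Read-back and normal form -/

/-- The free critical Ising two-point function of `Ω_δ`, library form: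
`T Ω δ x y = ⟨σ_x σ_y⟩^free_{Ω_δ; β_c(2), 0}` on `discreteDomainGraph Ω δ`, volume
`meshDomainFinset Ω δ`. -/
def T (Ω : Set ℂ) (δ : ℝ) (x y : Site 2) : ℝ :=
  isingTwoPoint (discreteDomainGraph Ω δ) (meshDomainFinset Ω δ) criticalBetaTwo 0 .free x y

/-- The INLINE two-point function of the crux (arbitrary `LocallyFinite` structure `lf`, inline
volume, inline `β`) is the library one. -/
theorem inline_eq_T (lf : ∀ (Ω : Set ℂ) (δ : ℝ), (discreteDomainGraph Ω δ).LocallyFinite)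
    (Ω : Set ℂ) (δ : ℝ) (x y : Site 2) :
    @isingTwoPoint _ (discreteDomainGraph Ω δ) _ (lf Ω δ)
        (if h : Bornology.IsBounded Ω ∧ 0 < δ then (meshDomain_finite h.1 h.2).toFinset else ∅)
        (Real.log (1 + Real.sqrt 2) / 2) 0 BoundaryCondition.free x y = T Ω δ x y := by
  have hlf : lf Ω δ = instLocallyFiniteDiscreteDomainGraph Ω δ := Subsingleton.elim _ _
  rw [hlf]
  unfold T meshDomainFinset criticalBetaTwo
  congr 1

/-- The crux's ratio `⟨σσ⟩_{Ω'_δ} / ⟨σσ⟩_{Ω_δ}` (real division, `x / 0 = 0`). -/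
def ratio (D D' : DobrushinDomain) (a b : ℝ → Site 2) (δ : ℝ) : ℝ :=
  T D'.carrier δ (a δ) (b δ) / T D.carrier δ (a δ) (b δ)

/-- NORMAL FORM of the crux: library two-point function, no `lf`. -/
def NormalForm : Prop :=
  ∀ (D D' : DobrushinDomain) (a b : ℝ → Site 2), SAW.IsEndpointApprox D a b →
    SAW.IsEndpointApprox D' a b → D'.carrier ⊆ D.carrier → D'.pt 0 = D.pt 0 → D'.pt 1 = D.pt 1 →
    (∃ ε : ℝ, 0 < ε ∧ D'.carrier ∩ Metric.ball (D.pt 0) ε = D.carrier ∩ Metric.ball (D.pt 0) ε ∧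
      D'.carrier ∩ Metric.ball (D.pt 1) ε = D.carrier ∩ Metric.ball (D.pt 1) ε) →
    ∀ (φ : ConformalEquiv upperHalfPlaneSet D.carrier), D.IsChordalUniformizing φ →
    ∀ (A : Set ℂ), A = closure (upperHalfPlaneSet \ {z | z ∈ upperHalfPlaneSet ∧ φ z ∈ D'.carrier}) →
    ∀ (Φ : ConformalEquiv (upperHalfPlaneSet \ A) upperHalfPlaneSet) (d : ℝ),
    IsRestrictionMap A Φ → HasRestrictionDeriv A Φ d →
    Tendsto (ratio D D' a b) (𝓝[>] 0) (𝓝 (d ^ ((1 : ℝ) / 2)))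

/-- **The crux is its normal form.** -/
theorem isingBoundaryRatio_iff_normalForm : IsingBoundaryRatio ↔ NormalForm := by
  constructor
  · intro h D D' a b hD hD' hsub h0 h1 hε φ hφ A hA Φ d hΦ hd
    have := h (fun Ω δ => instLocallyFiniteDiscreteDomainGraph Ω δ) D D' a b hD hD' hsub h0 h1 hε
      φ hφ A hA Φ d hΦ hd
    simp only [inline_eq_T] at this
    exact this
  · intro h lf D D' a b hD hD' hsub h0 h1 hε φ hφ A hA Φ d hΦ hd
    simp only [inline_eq_T]
    exact h D D' a b hD hD' hsub h0 h1 hε φ hφ A hA Φ d hΦ hd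

/-! ## §1 Idle hypotheses: the marked points agree automatically -/

/-- The two endpoint approximations force `D'.pt i = D.pt i` (uniqueness of limits along the
non-trivial filter `𝓝[>] 0`). -/
theorem pt_eq_of_isEndpointApprox {D D' : DobrushinDomain} {a b : ℝ → Site 2}
    (h : SAW.IsEndpointApprox D a b) (h' : SAW.IsEndpointApprox D' a b) :
    D'.pt 0 = D.pt 0 ∧ D'.pt 1 = D.pt 1 :=
  ⟨tendsto_nhds_unique h'.tendsto_fst h.tendsto_fst, tendsto_nhds_unique h'.tendsto_snd h.tendsto_snd⟩

/-- The crux with the two hypotheses `D'.pt 0 = D.pt 0`, `D'.pt 1 = D.pt 1` deleted. -/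
def WithoutPtEq : Prop :=
  ∀ (D D' : DobrushinDomain) (a b : ℝ → Site 2), SAW.IsEndpointApprox D a b →
    SAW.IsEndpointApprox D' a b → D'.carrier ⊆ D.carrier →
    (∃ ε : ℝ, 0 < ε ∧ D'.carrier ∩ Metric.ball (D.pt 0) ε = D.carrier ∩ Metric.ball (D.pt 0) ε ∧
      D'.carrier ∩ Metric.ball (D.pt 1) ε = D.carrier ∩ Metric.ball (D.pt 1) ε) →
    ∀ (φ : ConformalEquiv upperHalfPlaneSet D.carrier), D.IsChordalUniformizing φ →
    ∀ (A : Set ℂ), A = closure (upperHalfPlaneSet \ {z | z ∈ upperHalfPlaneSet ∧ φ z ∈ D'.carrier}) →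
    ∀ (Φ : ConformalEquiv (upperHalfPlaneSet \ A) upperHalfPlaneSet) (d : ℝ),
    IsRestrictionMap A Φ → HasRestrictionDeriv A Φ d →
    Tendsto (ratio D D' a b) (𝓝[>] 0) (𝓝 (d ^ ((1 : ℝ) / 2)))

/-- Deleting the marked-point equalities does NOT change the crux (they are idle). -/
theorem normalForm_iff_withoutPtEq : NormalForm ↔ WithoutPtEq := by
  constructor
  · intro h D D' a b hD hD' hsub hε φ hφ A hA Φ d hΦ hd
    obtain ⟨h0, h1⟩ := pt_eq_of_isEndpointApprox hD hD'
    exact h D D' a b hD hD' hsub h0 h1 hε φ hφ A hA Φ d hΦ hd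
  · intro h D D' a b hD hD' hsub _ _ hε φ hφ A hA Φ d hΦ hd
    exact h D D' a b hD hD' hsub hε φ hφ A hA Φ d hΦ hd

/-! ## §2 Junk values of the inline two-point function -/

/-- Diagonal sites: `T Ω δ x x = 1` (so the ratio is `1` whenever `a δ = b δ`). -/
@[simp] theorem T_self (Ω : Set ℂ) (δ : ℝ) (x : Site 2) : T Ω δ x x = 1 :=
  isingTwoPoint_self _ _ _ _ _ x

/-- Free-boundary junk: two sites OUTSIDE the volume are frozen to `+1`, `⟨σ_x σ_y⟩ = 1`. -/
theorem isingTwoPoint_free_eq_one_of_notMem {V : Type*} [DecidableEq V] (G : SimpleGraph V)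
    [G.LocallyFinite] (Λ : Finset V) (β h : ℝ) {x y : V} (hx : x ∉ Λ) (hy : y ∉ Λ) :
    isingTwoPoint G Λ β h .free x y = 1 := by
  rw [isingTwoPoint, isingExpect, integral_isingMeasure _ _ _ _ _ (measurable_spinPair x y)]
  have hsp : ∀ τ : Λ → ℤˣ, spinPair x y (glue Λ τ .free) = 1 := fun τ => by
    simp [spinPair, spinAt, glue_apply_of_notMem _ _ _ hx, glue_apply_of_notMem _ _ _ hy]
  simp only [hsp, mul_one]
  exact div_self (isingPartitionFunction_pos G Λ β h .free).ne'

theorem meshDomainFinset_of_nonpos (Ω : Set ℂ) {δ : ℝ} (hδ : δ ≤ 0) : meshDomainFinset Ω δ = ∅ := by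
  unfold meshDomainFinset
  rw [dif_neg]
  exact fun h => absurd h.2 (not_lt.2 hδ)

/-- Non-positive mesh: the inline volume is `∅`, so `T Ω δ x y = 1` and the crux's ratio is
IDENTICALLY `1` on `δ ≤ 0` (invisible along `𝓝[>] 0`). -/
theorem T_of_nonpos (Ω : Set ℂ) {δ : ℝ} (hδ : δ ≤ 0) (x y : Site 2) : T Ω δ x y = 1 := by
  unfold T
  rw [meshDomainFinset_of_nonpos Ω hδ]
  exact isingTwoPoint_free_eq_one_of_notMem _ _ _ _ (Finset.notMem_empty x) (Finset.notMem_empty y)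

theorem ratio_of_nonpos (D D' : DobrushinDomain) (a b : ℝ → Site 2) {δ : ℝ} (hδ : δ ≤ 0) :
    ratio D D' a b δ = 1 := by
  simp [ratio, T_of_nonpos _ hδ]

/-- STRENGTHENING REFUTED (modulo an off-diagonal datum): with the two-sided filter `𝓝 0` in place
of `𝓝[>] 0` the conclusion fails for every datum with `0 ≤ d ≠ 1`, because the ratio is `≡ 1` on
`δ ≤ 0`. (On the diagonal `d = 1` and the two-sided version happens to hold.) -/
theorem not_tendsto_twoSided (D D' : DobrushinDomain) (a b : ℝ → Site 2) {d : ℝ} (hd0 : 0 ≤ d)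
    (hd : d ≠ 1) : ¬ Tendsto (ratio D D' a b) (𝓝 0) (𝓝 (d ^ ((1 : ℝ) / 2))) := by
  intro h
  have h1 : Tendsto (ratio D D' a b) (𝓝[≤] 0) (𝓝 1) := by
    refine (tendsto_const_nhds (x := (1 : ℝ))).congr' ?_
    filter_upwards [self_mem_nhdsWithin] with δ hδ
    exact (ratio_of_nonpos D D' a b hδ).symm
  have heq : d ^ ((1 : ℝ) / 2) = 1 := tendsto_nhds_unique (h.mono_left nhdsWithin_le_nhds) h1
  have : d = 1 := by
    have h2 := congrArg (fun t : ℝ => t ^ (2 : ℕ)) heq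
    simp only [one_pow] at h2
    rwa [← Real.rpow_mul_natCast hd0, show (1 : ℝ) / 2 * (2 : ℕ) = 1 by norm_num, Real.rpow_one] at h2
  exact hd this

/-! ## §3 Lattice facts at `δ > 0`: membership, positivity, GKS sandwich, nesting -/

theorem mem_meshDomain_of_reachable_ne {Ω : Set ℂ} {δ : ℝ} {x y : Site 2}
    (h : (discreteDomainGraph Ω δ).Reachable x y) (hne : x ≠ y) : x ∈ meshDomain Ω δ := by
  obtain ⟨p⟩ := h
  cases p with
  | nil => exact absurd rfl hne
  | cons hadj _ => exact (discreteDomainGraph_adj_iff.1 hadj).2.1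

theorem mem_meshDomainFinset_of_reachable_ne {Ω : Set ℂ} {δ : ℝ} (hΩ : Bornology.IsBounded Ω)
    (hδ : 0 < δ) {x y : Site 2} (h : (discreteDomainGraph Ω δ).Reachable x y) (hne : x ≠ y) :
    x ∈ meshDomainFinset Ω δ ∧ y ∈ meshDomainFinset Ω δ := by
  rw [← Finset.mem_coe, ← Finset.mem_coe, coe_meshDomainFinset hΩ hδ]
  exact ⟨mem_meshDomain_of_reachable_ne h hne, mem_meshDomain_of_reachable_ne h.symm hne.symm⟩

/-- PATH WITNESS for the high-temperature expansion: the edge set of a self-avoiding path from `x`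
to `y ≠ x` inside `Λ` has odd vertices exactly `{x, y}`, so it is a term of `g_Λ({x} ∆ {y})` and
`g_Λ({x} ∆ {y}) ≥ t^{|p|} > 0` for `t > 0`. -/
theorem hteSum_pos_of_path {V : Type*} [DecidableEq V] (G : SimpleGraph V) [G.LocallyFinite]
    (Λ : Finset V) {t : ℝ} (ht : 0 < t) {x y : V} (hne : x ≠ y) (p : G.Walk x y) (hp : p.IsPath)
    (hΛ : ∀ v ∈ p.support, v ∈ Λ) : 0 < hteSum G Λ t ({x} ∆ {y}) := by
  set F : Finset (Sym2 V) := p.edges.toFinset with hF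
  have hFsub : F ⊆ edgesIn G Λ := fun e he => by
    rw [hF, List.mem_toFinset] at he
    rw [mem_edgesIn_iff]
    exact ⟨p.edges_subset_edgeSet he, fun v hv => hΛ v (SimpleGraph.Walk.mem_support_of_mem_edges he hv)⟩
  have hcount : ∀ v, (F.filter fun e => v ∈ e).card = p.edges.countP fun e => v ∈ e := fun v => by
    rw [List.countP_eq_length_filter, ← List.toFinset_card_of_nodup (hp.isTrail.edges_nodup.filter _),
      List.toFinset_filter, hF]
    congr 1
    ext e
    simp
  have hodd : oddVerts Λ F = {x} ∆ {y} := by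
    ext v
    rw [oddVerts, Finset.mem_filter, hcount, ← Nat.not_even_iff_odd, hp.isTrail.even_countP_edges_iff,
      Finset.mem_symmDiff, Finset.mem_singleton, Finset.mem_singleton]
    constructor
    · rintro ⟨-, h⟩
      by_cases hvx : v = x
      · exact Or.inl ⟨hvx, hvx ▸ hne⟩
      · have hvy : v = y := by
          by_contra hvy
          exact h fun _ => ⟨hvx, hvy⟩
        exact Or.inr ⟨hvy, hvy ▸ hne.symm⟩
    · rintro (⟨rfl, -⟩ | ⟨rfl, -⟩)
      · exact ⟨hΛ _ p.start_mem_support, fun h => (h hne).1 rfl⟩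
      · exact ⟨hΛ _ p.end_mem_support, fun h => (h hne).2 rfl⟩
  have hmem : F ∈ (edgesIn G Λ).powerset.filter fun F => oddVerts Λ F = {x} ∆ {y} :=
    Finset.mem_filter.2 ⟨Finset.mem_powerset.2 hFsub, hodd⟩
  unfold hteSum
  exact lt_of_lt_of_le (pow_pos ht _)
    (Finset.single_le_sum (f := fun F : Finset (Sym2 V) => t ^ F.card) (fun _ _ => pow_nonneg ht.le _) hmem)

theorem tanh_criticalBetaTwo_pos : 0 < Real.tanh criticalBetaTwo := by
  rw [DiluteLoopModel.tanh_criticalBetaTwo, sub_pos]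
  exact Real.lt_sqrt_of_sq_lt (by norm_num)

/-- STRICT POSITIVITY: for `δ > 0` and bounded `Ω`, if `x` and `y` are joined in `Ω_δ` then
`0 < T Ω δ x y` (high-temperature expansion `⟨σ_xσ_y⟩ = g({x}∆{y})/g(∅)` + path witness). -/
theorem T_pos_of_reachable {Ω : Set ℂ} {δ : ℝ} (hΩ : Bornology.IsBounded Ω) (hδ : 0 < δ)
    {x y : Site 2} (h : (discreteDomainGraph Ω δ).Reachable x y) : 0 < T Ω δ x y := by
  by_cases hne : x = y
  · subst hne; simp
  obtain ⟨hx, hy⟩ := mem_meshDomainFinset_of_reachable_ne hΩ hδ h hne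
  obtain ⟨p⟩ := h
  unfold T
  rw [isingTwoPoint_free_eq_hteSum_div _ _ _ hx hy]
  refine div_pos ?_ (hteSum_empty_pos _ _ _)
  refine hteSum_pos_of_path _ _ tanh_criticalBetaTwo_pos hne p.toPath p.toPath.2 fun v hv => ?_
  rw [← Finset.mem_coe, coe_meshDomainFinset hΩ hδ]
  have hx' : x ∈ meshDomain Ω δ := by
    rw [← coe_meshDomainFinset hΩ hδ]; exact hx
  exact DiluteLoopModel.support_subset_meshDomain _ hx' v hv

/-- `|T| ≤ 1` always. -/
theorem abs_T_le_one (Ω : Set ℂ) (δ : ℝ) (x y : Site 2) : |T Ω δ x y| ≤ 1 := by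
  unfold T
  rw [isingTwoPoint, spinPair_eq_spinProduct_symmDiff, ← isingCorr]
  exact abs_isingCorr_le_one _ _ _ _ _ _

theorem T_le_one (Ω : Set ℂ) (δ : ℝ) (x y : Site 2) : T Ω δ x y ≤ 1 :=
  (le_abs_self _).trans (abs_T_le_one Ω δ x y)

theorem meshGraph_mono {Ω' Ω : Set ℂ} (h : Ω' ⊆ Ω) (δ : ℝ) : meshGraph Ω' δ ≤ meshGraph Ω δ := by
  intro x y hxy
  rw [meshGraph_adj_iff] at hxy ⊢
  exact ⟨hxy.1, hxy.2.trans (closure_mono h)⟩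

theorem meshVertices_mono {Ω' Ω : Set ℂ} (h : Ω' ⊆ Ω) (δ : ℝ) : meshVertices Ω' δ ⊆ meshVertices Ω δ :=
  fun _ hx => h hx

/-- GRAPH INCLUSION: if `Ω' ⊆ Ω` and `meshDomain Ω' δ ⊆ meshDomain Ω δ` then `Ω'_δ ≤ Ω_δ`. -/
theorem discreteDomainGraph_mono {Ω' Ω : Set ℂ} {δ : ℝ} (hsub : Ω' ⊆ Ω)
    (hΛ : meshDomain Ω' δ ⊆ meshDomain Ω δ) : discreteDomainGraph Ω' δ ≤ discreteDomainGraph Ω δ := by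
  intro x y hxy
  rw [discreteDomainGraph_adj_iff] at hxy ⊢
  obtain ⟨hadj, hx, hy⟩ := hxy
  exact ⟨meshGraph_mono hsub δ hadj, hΛ hx, hΛ hy⟩

/-- GKS SANDWICH (Griffiths II, proved in the tree): for `δ > 0`, `Ω' ⊆ Ω` bounded with nested mesh
domains and `x, y ∈ Ω'_δ`: `T Ω' δ x y ≤ T Ω δ x y` (fewer edges and a smaller free volume can only
decrease ferromagnetic correlations). -/
theorem T_mono {Ω' Ω : Set ℂ} {δ : ℝ} (hΩ : Bornology.IsBounded Ω) (hδ : 0 < δ) (hsub : Ω' ⊆ Ω)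
    (hΛ : meshDomain Ω' δ ⊆ meshDomain Ω δ) {x y : Site 2} (hx : x ∈ meshDomainFinset Ω' δ)
    (hy : y ∈ meshDomainFinset Ω' δ) : T Ω' δ x y ≤ T Ω δ x y := by
  have hΩ' : Bornology.IsBounded Ω' := hΩ.subset hsub
  have hΛ' : meshDomainFinset Ω' δ ⊆ meshDomainFinset Ω δ := by
    intro v hv
    rw [← Finset.mem_coe, coe_meshDomainFinset hΩ hδ]
    rw [← Finset.mem_coe, coe_meshDomainFinset hΩ' hδ] at hv
    exact hΛ hv
  have hA : ({x} ∆ {y} : Finset (Site 2)) ⊆ meshDomainFinset Ω' δ :=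
    symmDiff_le_sup.trans (sup_le (Finset.singleton_subset_iff.2 hx) (Finset.singleton_subset_iff.2 hy))
  unfold T
  rw [isingTwoPoint, spinPair_eq_spinProduct_symmDiff, ← isingCorr, isingTwoPoint,
    spinPair_eq_spinProduct_symmDiff, ← isingCorr]
  calc isingCorr (discreteDomainGraph Ω' δ) (meshDomainFinset Ω' δ) criticalBetaTwo 0 .free ({x} ∆ {y})
      ≤ isingCorr (discreteDomainGraph Ω δ) (meshDomainFinset Ω' δ) criticalBetaTwo 0 .free ({x} ∆ {y}) :=
        isingCorr_free_mono_graph (fun Λ A B β h bc => GKSInequalities.gks_two_holds _)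
          (discreteDomainGraph_mono hsub hΛ) criticalBetaTwo_pos.le le_rfl hA
    _ ≤ isingCorr (discreteDomainGraph Ω δ) (meshDomainFinset Ω δ) criticalBetaTwo 0 .free ({x} ∆ {y}) :=
        isingCorr_free_mono_volume_of_gks _ (fun G' _ Λ A B β h bc => GKSInequalities.gks_two_holds G')
          criticalBetaTwo_pos.le le_rfl hA hΛ'

/-- The inclusion `Ω'_δ-vertices → Ω_δ-vertices` as a homomorphism of mesh vertex graphs. -/
def meshVertexHom {Ω' Ω : Set ℂ} (h : Ω' ⊆ Ω) (δ : ℝ) : meshVertexGraph Ω' δ →g meshVertexGraph Ω δ where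
  toFun v := ⟨v.1, meshVertices_mono h δ v.2⟩
  map_rel' hadj := meshGraph_mono h δ hadj

/-- `meshDomain` is saturated under reachability in the mesh vertex graph (it is a union of
supports of connected components; tree lemma `mem_meshDomain_of_adj`). -/
theorem mem_meshDomain_of_reachable_vertex {Ω : Set ℂ} {δ : ℝ} {x y : meshVertices Ω δ}
    (hx : (x : Site 2) ∈ meshDomain Ω δ) (h : (meshVertexGraph Ω δ).Reachable x y) :
    (y : Site 2) ∈ meshDomain Ω δ := by
  obtain ⟨p⟩ := h
  induction p with
  | nil => exact hx
  | cons hadj _ ih => exact ih (mem_meshDomain_of_adj hx hadj)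

/-- Eventually the two lattice endpoints are distinct (their mesh points converge to the distinct
marked points). -/
theorem eventually_ne {D : DobrushinDomain} {a b : ℝ → Site 2} (h : SAW.IsEndpointApprox D a b) :
    ∀ᶠ δ in 𝓝[>] (0 : ℝ), a δ ≠ b δ := by
  have h01 : D.pt 0 ≠ D.pt 1 := fun h => absurd (D.pt_injective h) (by decide)
  have hr : 0 < dist (D.pt 0) (D.pt 1) := dist_pos.2 h01
  filter_upwards [Metric.tendsto_nhds.1 h.tendsto_fst _ (half_pos hr),
    Metric.tendsto_nhds.1 h.tendsto_snd _ (half_pos hr)] with δ ha hb hab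
  rw [hab] at ha
  have := dist_triangle_left (D.pt 0) (D.pt 1) (meshPoint δ (b δ))
  linarith

/-- THE DISCRETE DOMAINS ARE NESTED EVENTUALLY: under the crux hypotheses (both endpoint
approximations, `D' ⊆ D`), `meshDomain D' δ ⊆ meshDomain D δ` for all small `δ > 0` — the largest
mesh component of the Jordan domain `D'` is eventually unique
(`JordanDomain.eventually_forall_mem_meshDomain'`), contains `a δ`, and `a δ ∈ Ω_δ`. So the tie
convention of `meshDomain` (union of all largest components) never bites. -/
theorem eventually_meshDomain_subset {D D' : DobrushinDomain} {a b : ℝ → Site 2}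
    (hD : SAW.IsEndpointApprox D a b) (hD' : SAW.IsEndpointApprox D' a b)
    (hsub : D'.carrier ⊆ D.carrier) :
    ∀ᶠ δ in 𝓝[>] (0 : ℝ), meshDomain D'.carrier δ ⊆ meshDomain D.carrier δ := by
  filter_upwards [hD.reachable, hD'.reachable, eventually_ne hD,
    D'.toJordanDomain.eventually_forall_mem_meshDomain' isCompact_empty (empty_subset _)]
    with δ hr hr' hne hconn y hy
  have ha' : a δ ∈ meshDomain D'.carrier δ := mem_meshDomain_of_reachable_ne hr' hne
  have ha : a δ ∈ meshDomain D.carrier δ := mem_meshDomain_of_reachable_ne hr hne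
  obtain ⟨hav, hyv, hreach⟩ := hconn.2 (a δ) ha' y hy
  have hreachD := hreach.map (meshVertexHom hsub δ)
  exact mem_meshDomain_of_reachable_vertex (x := ⟨a δ, meshVertices_mono hsub δ hav⟩) ha hreachD

/-- THE OUTER ENDPOINT APPROXIMATION IS IDLE: if `(a_δ, b_δ)` is an endpoint approximation of the
SUBdomain `D' ⊆ D` (same marked points), it is one of `D`. The bulk component of `D'_δ` (eventually
the unique largest one, `JordanDomain.eventually_forall_mem_meshDomain'`) contains the lattice point
nearest to a fixed interior point `z₀ ∈ D'`, which lies in the bulk component of `D_δ` too; mesh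
paths of `D'` are mesh paths of `D`, and `meshDomain` is saturated under them. (The converse
implication fails for comb-like `D'`: see the work file.) -/
theorem isEndpointApprox_of_subdomain {D D' : DobrushinDomain} {a b : ℝ → Site 2}
    (h' : SAW.IsEndpointApprox D' a b) (hsub : D'.carrier ⊆ D.carrier) (h0 : D'.pt 0 = D.pt 0)
    (h1 : D'.pt 1 = D.pt 1) : SAW.IsEndpointApprox D a b := by
  refine ⟨?_, h0 ▸ h'.tendsto_fst, h1 ▸ h'.tendsto_snd⟩
  -- a closed disc inside `D'`
  obtain ⟨z₀, hz₀⟩ := D'.nonempty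
  obtain ⟨r, hr, hball⟩ := Metric.isOpen_iff.1 D'.isOpen z₀ hz₀
  have hK : IsCompact (closedBall z₀ (r / 2)) := isCompact_closedBall _ _
  have hKD' : closedBall z₀ (r / 2) ⊆ D'.carrier := (closedBall_subset_ball (by linarith)).trans hball
  have hKD : closedBall z₀ (r / 2) ⊆ D.carrier := hKD'.trans hsub
  filter_upwards [h'.reachable, D'.toJordanDomain.eventually_forall_mem_meshDomain' hK hKD',
    D.toJordanDomain.eventually_forall_mem_meshDomain' hK hKD, Ioo_mem_nhdsGT (half_pos hr)]
    with δ hr' hD' hD hδ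
  by_cases hne : a δ = b δ
  · rw [hne]
  set v : Site 2 := nearestSite δ z₀ with hv
  have hvK : meshPoint δ v ∈ closedBall z₀ (r / 2) :=
    mem_closedBall.2 ((dist_meshPoint_nearestSite_le hδ.1 z₀).trans hδ.2.le)
  have hvD' : v ∈ meshDomain D'.carrier δ := hD'.1 v hvK
  have hvD : v ∈ meshDomain D.carrier δ := hD.1 v hvK
  -- `a δ`, `b δ` lie in the bulk of `D'_δ`
  have ha' : a δ ∈ meshDomain D'.carrier δ := mem_meshDomain_of_reachable_ne hr' hne
  have hb' : b δ ∈ meshDomain D'.carrier δ := mem_meshDomain_of_reachable_ne hr'.symm (Ne.symm hne)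
  obtain ⟨hvv, hav, hva⟩ := hD'.2 v hvD' (a δ) ha'
  obtain ⟨hvv', hbv, hvb⟩ := hD'.2 v hvD' (b δ) hb'
  -- transport to the mesh vertex graph of `D`
  have hva' : (meshVertexGraph D.carrier δ).Reachable (meshVertexHom hsub δ ⟨v, hvv⟩)
      (meshVertexHom hsub δ ⟨a δ, hav⟩) := hva.map (meshVertexHom hsub δ)
  have hvb' : (meshVertexGraph D.carrier δ).Reachable (meshVertexHom hsub δ ⟨v, hvv'⟩)
      (meshVertexHom hsub δ ⟨b δ, hbv⟩) := hvb.map (meshVertexHom hsub δ)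
  have haD : a δ ∈ meshDomain D.carrier δ :=
    mem_meshDomain_of_reachable_vertex (x := ⟨v, meshVertices_mono hsub δ hvv⟩) hvD hva'
  obtain ⟨q⟩ := hva'.symm.trans hvb'
  exact reachable_discreteDomainGraph_of_walk q haD

/-- The crux with the OUTER endpoint approximation `SAW.IsEndpointApprox D a b` deleted. -/
def WithoutOuterApprox : Prop :=
  ∀ (D D' : DobrushinDomain) (a b : ℝ → Site 2),
    SAW.IsEndpointApprox D' a b → D'.carrier ⊆ D.carrier → D'.pt 0 = D.pt 0 → D'.pt 1 = D.pt 1 →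
    (∃ ε : ℝ, 0 < ε ∧ D'.carrier ∩ Metric.ball (D.pt 0) ε = D.carrier ∩ Metric.ball (D.pt 0) ε ∧
      D'.carrier ∩ Metric.ball (D.pt 1) ε = D.carrier ∩ Metric.ball (D.pt 1) ε) →
    ∀ (φ : ConformalEquiv upperHalfPlaneSet D.carrier), D.IsChordalUniformizing φ →
    ∀ (A : Set ℂ), A = closure (upperHalfPlaneSet \ {z | z ∈ upperHalfPlaneSet ∧ φ z ∈ D'.carrier}) →
    ∀ (Φ : ConformalEquiv (upperHalfPlaneSet \ A) upperHalfPlaneSet) (d : ℝ),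
    IsRestrictionMap A Φ → HasRestrictionDeriv A Φ d →
    Tendsto (ratio D D' a b) (𝓝[>] 0) (𝓝 (d ^ ((1 : ℝ) / 2)))

/-- The OUTER endpoint approximation is IDLE: deleting it gives an equivalent statement. (The
INNER one `SAW.IsEndpointApprox D' a b` is NOT idle: for comb-like hull subdomains `D'` whose
corridors accumulate at `a`, endpoints `a_δ ∈ Ω_δ ∖ Ω'_δ` exist along `δ → 0`, where the inline
`⟨σ_{a_δ}σ_{b_δ}⟩_{Ω'_δ}` is the frozen-spin junk `⟨σ_{b_δ}⟩ = 0` and the ratio vanishes — prose,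
work file.) -/
theorem normalForm_iff_withoutOuterApprox : NormalForm ↔ WithoutOuterApprox := by
  constructor
  · intro h D D' a b hD' hsub h0 h1 hε φ hφ A hA Φ d hΦ hd
    exact h D D' a b (isEndpointApprox_of_subdomain hD' hsub h0 h1) hD' hsub h0 h1 hε φ hφ A hA Φ d hΦ hd
  · intro h D D' a b _ hD' hsub h0 h1 hε φ hφ A hA Φ d hΦ hd
    exact h D D' a b hD' hsub h0 h1 hε φ hφ A hA Φ d hΦ hd

/-- Eventually the ratio IS the route's loop-model object at the Ising point,
`R_δ(1; D, D') = domainBoundaryRatio ⟨1, ½, tanh β_c⟩ D' D δ (a δ) (b δ)` (the `n = 1` case of the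
informal crux IsingWindow), by the tree's high-temperature identity
`DiluteLoopModel.domainBoundaryRatio_isingPoint`. -/
theorem eventually_ratio_eq_domainBoundaryRatio {D D' : DobrushinDomain} {a b : ℝ → Site 2}
    (hD : SAW.IsEndpointApprox D a b) (hD' : SAW.IsEndpointApprox D' a b)
    (hsub : D'.carrier ⊆ D.carrier) :
    ∀ᶠ δ in 𝓝[>] (0 : ℝ), ratio D D' a b δ =
      (⟨1, 2⁻¹, Real.tanh criticalBetaTwo⟩ : DiluteLoopModel ℝ).domainBoundaryRatio
        D'.carrier D.carrier δ (a δ) (b δ) := by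
  filter_upwards [hD.reachable, hD'.reachable, eventually_ne hD, self_mem_nhdsWithin]
    with δ hr hr' hne hδ
  obtain ⟨hx, hy⟩ := mem_meshDomainFinset_of_reachable_ne D.isBounded hδ hr hne
  obtain ⟨hx', hy'⟩ := mem_meshDomainFinset_of_reachable_ne (D.isBounded.subset hsub) hδ hr' hne
  rw [DiluteLoopModel.domainBoundaryRatio_isingPoint hx' hy' hx hy]
  rfl

/-! ## §4 Load-bearing normalisations: without `IsRestrictionMap` / `HasRestrictionDeriv` the
statement is contradictory already on the diagonal `D' = D` -/

/-- The pulled-back hull of `D` itself is empty: `closure (ℍ ∖ φ⁻¹ D) = ∅`. -/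
theorem hull_self_eq_empty (D : DobrushinDomain) (φ : ConformalEquiv upperHalfPlaneSet D.carrier) :
    closure (upperHalfPlaneSet \ {z | z ∈ upperHalfPlaneSet ∧ φ z ∈ D.carrier}) = ∅ := by
  have : {z | z ∈ upperHalfPlaneSet ∧ φ z ∈ D.carrier} = upperHalfPlaneSet := by
    ext z
    exact ⟨fun hz => hz.1, fun hz => ⟨hz, φ.mapsTo hz⟩⟩
  rw [this, _root_.sdiff_self, Set.bot_eq_empty, closure_empty]

/-- The dilation `z ↦ c z` of `ℍₒ` viewed as a conformal equivalence `ℍₒ ∖ ∅ → ℍₒ`. -/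
def smulEmpty (c : ℝ) (hc : 0 < c) : ConformalEquiv (upperHalfPlaneSet \ ∅) upperHalfPlaneSet :=
  (ConformalEquiv.smulUpperHalfPlane c hc).copy _ _ sdiff_empty rfl

@[simp] theorem smulEmpty_apply (c : ℝ) (hc : 0 < c) (z : ℂ) : smulEmpty c hc z = c • z := rfl

/-- `z ↦ c z` has "restriction derivative" `c` at `0` for the empty hull. -/
theorem hasRestrictionDeriv_smulEmpty (c : ℝ) (hc : 0 < c) : HasRestrictionDeriv ∅ (smulEmpty c hc) c := by
  unfold HasRestrictionDeriv
  refine (tendsto_const_nhds (x := ((c : ℝ) : ℂ))).congr' ?_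
  filter_upwards [self_mem_nhdsWithin] with z hz
  have hz0 : z ≠ 0 := by
    rintro rfl
    exact absurd hz.1 (by simp [upperHalfPlaneSet])
  rw [smulEmpty_apply, Complex.real_smul, mul_div_assoc, div_self hz0, mul_one]

theorem one_rpow_half_ne_four_rpow_half : (1 : ℝ) ^ ((1 : ℝ) / 2) ≠ (4 : ℝ) ^ ((1 : ℝ) / 2) := by
  rw [Real.one_rpow, show (4 : ℝ) = 2 ^ (2 : ℝ) by norm_num, ← Real.rpow_mul (by norm_num)]
  norm_num

/-- The crux with `IsRestrictionMap A Φ` deleted. -/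
def WithoutIsRestrictionMap : Prop :=
  ∀ (D D' : DobrushinDomain) (a b : ℝ → Site 2), SAW.IsEndpointApprox D a b →
    SAW.IsEndpointApprox D' a b → D'.carrier ⊆ D.carrier → D'.pt 0 = D.pt 0 → D'.pt 1 = D.pt 1 →
    (∃ ε : ℝ, 0 < ε ∧ D'.carrier ∩ Metric.ball (D.pt 0) ε = D.carrier ∩ Metric.ball (D.pt 0) ε ∧
      D'.carrier ∩ Metric.ball (D.pt 1) ε = D.carrier ∩ Metric.ball (D.pt 1) ε) →
    ∀ (φ : ConformalEquiv upperHalfPlaneSet D.carrier), D.IsChordalUniformizing φ →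
    ∀ (A : Set ℂ), A = closure (upperHalfPlaneSet \ {z | z ∈ upperHalfPlaneSet ∧ φ z ∈ D'.carrier}) →
    ∀ (Φ : ConformalEquiv (upperHalfPlaneSet \ A) upperHalfPlaneSet) (d : ℝ),
    HasRestrictionDeriv A Φ d →
    Tendsto (ratio D D' a b) (𝓝[>] 0) (𝓝 (d ^ ((1 : ℝ) / 2)))

/-- ANY PROOF MUST USE `IsRestrictionMap`: without it, on the diagonal `D' = D` (hull `A = ∅`) the
dilations `z ↦ z` and `z ↦ 4z` are both admissible `Φ`, with `d = 1` and `d = 4`, and the ratio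
would have the two limits `1 ≠ 2`. Witness: `D = D' =` unit disc, any endpoint approximation
(`SAW.exists_isEndpointApprox`), any chordal uniformizer (`exists_isChordalUniformizing_holds`). -/
theorem isingBoundaryRatio_false_without_IsRestrictionMap : ¬ WithoutIsRestrictionMap := by
  intro h
  set D := DobrushinDomain.unitDisc
  obtain ⟨a, b, hab⟩ := SAW.exists_isEndpointApprox D
  obtain ⟨φ, hφ⟩ := MarkedDomain.exists_isChordalUniformizing_holds D
  have hε : ∃ ε : ℝ, 0 < ε ∧ D.carrier ∩ Metric.ball (D.pt 0) ε = D.carrier ∩ Metric.ball (D.pt 0) ε ∧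
      D.carrier ∩ Metric.ball (D.pt 1) ε = D.carrier ∩ Metric.ball (D.pt 1) ε := ⟨1, one_pos, rfl, rfl⟩
  have hA : (∅ : Set ℂ) = closure (upperHalfPlaneSet \ {z | z ∈ upperHalfPlaneSet ∧ φ z ∈ D.carrier}) :=
    (hull_self_eq_empty D φ).symm
  have h1 := h D D a b hab hab subset_rfl rfl rfl hε φ hφ ∅ hA (smulEmpty 1 one_pos) 1
    (hasRestrictionDeriv_smulEmpty 1 one_pos)
  have h4 := h D D a b hab hab subset_rfl rfl rfl hε φ hφ ∅ hA (smulEmpty 4 (by norm_num)) 4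
    (hasRestrictionDeriv_smulEmpty 4 (by norm_num))
  exact one_rpow_half_ne_four_rpow_half (tendsto_nhds_unique h1 h4)

/-- The crux with `HasRestrictionDeriv A Φ d` deleted (so `d` is a free real parameter). -/
def WithoutHasRestrictionDeriv : Prop :=
  ∀ (D D' : DobrushinDomain) (a b : ℝ → Site 2), SAW.IsEndpointApprox D a b →
    SAW.IsEndpointApprox D' a b → D'.carrier ⊆ D.carrier → D'.pt 0 = D.pt 0 → D'.pt 1 = D.pt 1 →
    (∃ ε : ℝ, 0 < ε ∧ D'.carrier ∩ Metric.ball (D.pt 0) ε = D.carrier ∩ Metric.ball (D.pt 0) ε ∧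
      D'.carrier ∩ Metric.ball (D.pt 1) ε = D.carrier ∩ Metric.ball (D.pt 1) ε) →
    ∀ (φ : ConformalEquiv upperHalfPlaneSet D.carrier), D.IsChordalUniformizing φ →
    ∀ (A : Set ℂ), A = closure (upperHalfPlaneSet \ {z | z ∈ upperHalfPlaneSet ∧ φ z ∈ D'.carrier}) →
    ∀ (Φ : ConformalEquiv (upperHalfPlaneSet \ A) upperHalfPlaneSet) (d : ℝ),
    IsRestrictionMap A Φ →
    Tendsto (ratio D D' a b) (𝓝[>] 0) (𝓝 (d ^ ((1 : ℝ) / 2)))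

/-- ANY PROOF MUST USE `HasRestrictionDeriv`: it is the only clause mentioning `d`; without it the
conclusion is claimed for `d = 1` and `d = 4` at once (diagonal `D' = D`, `Φ = id`). -/
theorem isingBoundaryRatio_false_without_HasRestrictionDeriv : ¬ WithoutHasRestrictionDeriv := by
  intro h
  set D := DobrushinDomain.unitDisc
  obtain ⟨a, b, hab⟩ := SAW.exists_isEndpointApprox D
  obtain ⟨φ, hφ⟩ := MarkedDomain.exists_isChordalUniformizing_holds D
  have hε : ∃ ε : ℝ, 0 < ε ∧ D.carrier ∩ Metric.ball (D.pt 0) ε = D.carrier ∩ Metric.ball (D.pt 0) ε ∧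
      D.carrier ∩ Metric.ball (D.pt 1) ε = D.carrier ∩ Metric.ball (D.pt 1) ε := ⟨1, one_pos, rfl, rfl⟩
  have hA : (∅ : Set ℂ) = closure (upperHalfPlaneSet \ {z | z ∈ upperHalfPlaneSet ∧ φ z ∈ D.carrier}) :=
    (hull_self_eq_empty D φ).symm
  have h1 := h D D a b hab hab subset_rfl rfl rfl hε φ hφ ∅ hA restrictionMapEmpty 1 isRestrictionMap_empty
  have h4 := h D D a b hab hab subset_rfl rfl rfl hε φ hφ ∅ hA restrictionMapEmpty 4 isRestrictionMap_empty
  exact one_rpow_half_ne_four_rpow_half (tendsto_nhds_unique h1 h4)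

/-! ## §5 Conformal side: what the hypotheses pin down -/

/-- On the diagonal the restriction data are forced: `IsRestrictionMap ∅ Φ` and
`HasRestrictionDeriv ∅ Φ d` imply `d = 1` (uniqueness of `Φ_∅ = id`, tree theorem
`IsStarHull.existsUnique_isRestrictionMap_holds`). -/
theorem deriv_eq_one_of_empty {Φ : ConformalEquiv (upperHalfPlaneSet \ ∅) upperHalfPlaneSet} {d : ℝ}
    (hΦ : IsRestrictionMap ∅ Φ) (hd : HasRestrictionDeriv ∅ Φ d) : d = 1 := by
  obtain ⟨Φ₀, -, huniq⟩ := IsStarHull.existsUnique_isRestrictionMap_holds isStarHull_empty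
  have h1 : EqOn Φ Φ₀ (upperHalfPlaneSet \ ∅) := huniq Φ hΦ
  have h2 : EqOn restrictionMapEmpty Φ₀ (upperHalfPlaneSet \ ∅) := huniq _ isRestrictionMap_empty
  haveI : (𝓝[upperHalfPlaneSet \ ∅] (0 : ℂ)).NeBot :=
    mem_closure_iff_nhdsWithin_neBot.1 isStarHull_empty.zero_mem_closure_diff
  have hconst : Tendsto (fun z => Φ z / z) (𝓝[upperHalfPlaneSet \ ∅] 0) (𝓝 ((1 : ℝ) : ℂ)) := by
    refine (tendsto_const_nhds (x := ((1 : ℝ) : ℂ))).congr' ?_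
    filter_upwards [self_mem_nhdsWithin] with z hz
    have hz0 : z ≠ 0 := by
      rintro rfl
      exact absurd hz.1 (by simp [upperHalfPlaneSet])
    rw [h1 hz, ← h2 hz, restrictionMapEmpty_apply, Complex.ofReal_one, div_self hz0]
  exact_mod_cast tendsto_nhds_unique hd hconst

/-- The ε-ball agreement of the crux makes `D'` a hull subdomain of `D` in the sense of
`MarkedDomain.IsHullSubdomain` (LSW's `A ∈ 𝒬*` transposed). -/
theorem isHullSubdomain_of_conds {D D' : DobrushinDomain} (hsub : D'.carrier ⊆ D.carrier)
    (h0 : D'.pt 0 = D.pt 0) (h1 : D'.pt 1 = D.pt 1)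
    (hε : ∃ ε : ℝ, 0 < ε ∧ D'.carrier ∩ Metric.ball (D.pt 0) ε = D.carrier ∩ Metric.ball (D.pt 0) ε ∧
      D'.carrier ∩ Metric.ball (D.pt 1) ε = D.carrier ∩ Metric.ball (D.pt 1) ε) :
    D.IsHullSubdomain D' := by
  obtain ⟨ε, hε, hb0, hb1⟩ := hε
  have key : ∀ p : ℂ, D'.carrier ∩ Metric.ball p ε = D.carrier ∩ Metric.ball p ε →
      p ∉ closure (D.carrier \ D'.carrier) := by
    intro p hp hcl
    rw [Metric.mem_closure_iff] at hcl
    obtain ⟨z, ⟨hzD, hzD'⟩, hdist⟩ := hcl ε hε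
    have hz : z ∈ D.carrier ∩ Metric.ball p ε := ⟨hzD, by rwa [Metric.mem_ball, dist_comm]⟩
    rw [← hp] at hz
    exact hzD' hz.1
  exact ⟨hsub, h0, h1, key _ hb0, key _ hb1⟩

/-- Under the crux hypotheses the pulled-back set `A` IS a `*`-hull and `d` IS the derivative
`Φ'_A(0) ∈ (0, 1]` (tree theorems `IsStarHull.pullbackHull`, `exists_hasRestrictionDeriv_holds`,
uniqueness). So the hypotheses on `(φ, A, Φ, d)` are satisfiable for every hull subdomain and pin
`d` uniquely: the crux is neither vacuous nor over-determined in its conformal variables. -/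
theorem starHull_and_deriv_mem {D D' : DobrushinDomain} (hsub : D'.carrier ⊆ D.carrier)
    (h0 : D'.pt 0 = D.pt 0) (h1 : D'.pt 1 = D.pt 1)
    (hε : ∃ ε : ℝ, 0 < ε ∧ D'.carrier ∩ Metric.ball (D.pt 0) ε = D.carrier ∩ Metric.ball (D.pt 0) ε ∧
      D'.carrier ∩ Metric.ball (D.pt 1) ε = D.carrier ∩ Metric.ball (D.pt 1) ε)
    {φ : ConformalEquiv upperHalfPlaneSet D.carrier} (hφ : D.IsChordalUniformizing φ) {A : Set ℂ}
    (hA : A = closure (upperHalfPlaneSet \ {z | z ∈ upperHalfPlaneSet ∧ φ z ∈ D'.carrier}))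
    {Φ : ConformalEquiv (upperHalfPlaneSet \ A) upperHalfPlaneSet} {d : ℝ}
    (hΦ : IsRestrictionMap A Φ) (hd : HasRestrictionDeriv A Φ d) :
    IsStarHull A ∧ 0 < d ∧ d ≤ 1 := by
  have hHull := isHullSubdomain_of_conds hsub h0 h1 hε
  have hstar : IsStarHull A := by
    rw [hA]
    exact IsStarHull.pullbackHull JordanDomain.isSimplyConnected_holds hφ hHull
  obtain ⟨d₀, hd₀, hd₀1, hd₀'⟩ := IsStarHull.exists_hasRestrictionDeriv_holds hstar hΦ
  have : d = d₀ := hd.unique hstar hd₀'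
  subst this
  exact ⟨hstar, hd₀, hd₀1⟩

/-- The claimed limit is in the GKS-admissible range. -/
theorem claimedLimit_mem_Ioc {d : ℝ} (hd : 0 < d) (hd1 : d ≤ 1) :
    d ^ ((1 : ℝ) / 2) ∈ Ioc (0 : ℝ) 1 :=
  ⟨Real.rpow_pos_of_pos hd _, Real.rpow_le_one hd.le hd1 (by norm_num)⟩

/-! ## §6 The diagonal `D' = D` is TRUE; the general position of the ratio -/

/-- Eventually along `𝓝[>] 0` the denominator of the crux is positive (no `0/0` junk). -/
theorem eventually_T_pos {D : DobrushinDomain} {a b : ℝ → Site 2} (h : SAW.IsEndpointApprox D a b) :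
    ∀ᶠ δ in 𝓝[>] (0 : ℝ), 0 < T D.carrier δ (a δ) (b δ) := by
  filter_upwards [h.reachable, self_mem_nhdsWithin] with δ hr hδ
  exact T_pos_of_reachable D.isBounded hδ hr

/-- On the diagonal the ratio is eventually IDENTICALLY `1`. -/
theorem eventually_ratio_self {D : DobrushinDomain} {a b : ℝ → Site 2} (h : SAW.IsEndpointApprox D a b) :
    ratio D D a b =ᶠ[𝓝[>] (0 : ℝ)] fun _ => 1 := by
  filter_upwards [eventually_T_pos h] with δ hδ
  exact div_self hδ.ne'

/-- THE DIAGONAL OF THE CRUX IS A THEOREM: for `D' = D` every admissible `(φ, A, Φ, d)` has `A = ∅`,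
`d = 1`, and the ratio tends to `1 = d^{1/2}`. (The statement is correctly normalised; a
refutation must be off-diagonal, i.e. must COMPUTE a non-trivial `Φ'_A(0)` against Ising
asymptotics — beyond any finite/decidable check.) -/
theorem crux_diag (D : DobrushinDomain) (a b : ℝ → Site 2) (hab : SAW.IsEndpointApprox D a b)
    (φ : ConformalEquiv upperHalfPlaneSet D.carrier) (A : Set ℂ)
    (hA : A = closure (upperHalfPlaneSet \ {z | z ∈ upperHalfPlaneSet ∧ φ z ∈ D.carrier}))
    (Φ : ConformalEquiv (upperHalfPlaneSet \ A) upperHalfPlaneSet) (d : ℝ)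
    (hΦ : IsRestrictionMap A Φ) (hd : HasRestrictionDeriv A Φ d) :
    Tendsto (ratio D D a b) (𝓝[>] 0) (𝓝 (d ^ ((1 : ℝ) / 2))) := by
  have hA0 : A = ∅ := hA.trans (hull_self_eq_empty D φ)
  subst hA0
  have hd1 : d = 1 := deriv_eq_one_of_empty hΦ hd
  subst hd1
  rw [Real.one_rpow]
  exact (tendsto_const_nhds (x := (1 : ℝ))).congr' (eventually_ratio_self hab).symm

/-- GENERAL POSITION OF THE RATIO (unconditional): under the crux hypotheses the ratio lies in
`(0, 1]` for all small `δ > 0` (strict positivity + GKS sandwich + eventual nesting, §3). -/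
theorem eventually_ratio_mem_Ioc {D D' : DobrushinDomain} {a b : ℝ → Site 2}
    (hD : SAW.IsEndpointApprox D a b) (hD' : SAW.IsEndpointApprox D' a b)
    (hsub : D'.carrier ⊆ D.carrier) :
    ∀ᶠ δ in 𝓝[>] (0 : ℝ), ratio D D' a b δ ∈ Ioc (0 : ℝ) 1 := by
  filter_upwards [hD.reachable, hD'.reachable, eventually_meshDomain_subset hD hD' hsub,
    eventually_ne hD, self_mem_nhdsWithin] with δ hr hr' hΛδ hneδ hδ
  obtain ⟨hx, hy⟩ := mem_meshDomainFinset_of_reachable_ne (D.isBounded.subset hsub) hδ hr' hneδ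
  refine ⟨div_pos (T_pos_of_reachable (D.isBounded.subset hsub) hδ hr')
    (T_pos_of_reachable D.isBounded hδ hr), ?_⟩
  exact div_le_one_of_le₀ (T_mono D.isBounded hδ hsub hΛδ hx hy)
    (T_pos_of_reachable D.isBounded hδ hr).le

/-- Hence ANY limit of the ratio is `≤ 1`: the crux's `d^{1/2} ≤ 1` is consistent (TIGHT on the
diagonal, where it is `1`). -/
theorem limit_le_one {D D' : DobrushinDomain} {a b : ℝ → Site 2}
    (hD : SAW.IsEndpointApprox D a b) (hD' : SAW.IsEndpointApprox D' a b)
    (hsub : D'.carrier ⊆ D.carrier) {L : ℝ}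
    (hL : Tendsto (ratio D D' a b) (𝓝[>] 0) (𝓝 L)) : L ≤ 1 :=
  le_of_tendsto hL ((eventually_ratio_mem_Ioc hD hD' hsub).mono fun _ h => h.2)

/-- NATURAL VARIANT REFUTED (relative to an off-diagonal datum): with a NEGATIVE exponent `e < 0`
in place of `1/2`, the conclusion `ratio → d^e` is false at every genuine sub-hull (`0 < d < 1`),
since `d^e > 1 ≥ lim`. (Positive exponents `e ≠ 1/2` cannot be separated from `1/2` by
monotonicity: that needs the McCoy–Wu asymptotics, not formalised.) -/
theorem not_tendsto_rpow_of_neg {D D' : DobrushinDomain} {a b : ℝ → Site 2}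
    (hD : SAW.IsEndpointApprox D a b) (hD' : SAW.IsEndpointApprox D' a b)
    (hsub : D'.carrier ⊆ D.carrier) {d e : ℝ} (hd : 0 < d) (hd1 : d < 1) (he : e < 0) :
    ¬ Tendsto (ratio D D' a b) (𝓝[>] 0) (𝓝 (d ^ e)) := fun hL =>
  absurd (limit_le_one hD hD' hsub hL) (not_le.2 (Real.one_lt_rpow_of_pos_of_lt_one_of_neg hd hd1 he))

/-! ## Numerics (kit jobs `j008794`, `j013886`) — THE `d^{1/2}` LAW IS CONFIRMED AT THE 1% LEVEL

Method (script `kwjob/main.py` in the refuter's folder; result files `numerics_validation_j008794.json`,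
`numerics_Lscan_j013886.json` attached to the item): exact free-fermion evaluation of
`⟨σ_aσ_b⟩^free_{β_c}` on finite planar lattice domains by the Kac–Ward determinant
`det(I − Λ) = Z_even²` (directed edges, turning phases `e^{iθ/2}`), with an external weight-1 path
`a → b` through the outer face giving `Z_∅ + Z_{ab}`; sparse-LU log-dets. SELF-TEST (j008794): on
five tiny boxes (≤ 13 sites) Kac–Ward agrees with brute-force enumeration of edge sets to relative
error `≤ 6·10⁻¹⁶`, and `Z_{ab}/Z_∅` agrees with the brute-force spin average to `10⁻¹⁵`.

Geometry: box `[-L,L]×[0,L]` (free b.c. on all four sides), boundary points `a = (−m,0)`,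
`b = (m,0)`; sub-domain = box minus the lattice slit `{0}×{0,…,ℓ}` (a hull attached to the
boundary arc between `a` and `b`). Half-plane CFT prediction for a weight-`h` boundary primary and
the slit map `Φ(z) = √(z²+ℓ²)`: `R := ⟨σ_aσ_b⟩_{box∖slit}/⟨σ_aσ_b⟩_{box} → (m²/(m²+ℓ²))^{2h}`, i.e.
for `h = ½`: `R* = 1/(1+(ℓ/m)²)` = `0.5` at `ℓ = m`, `0.8` at `ℓ = m/2`.

L-scan (j013886), `R(m, ℓ, L)`:
  m=12 ℓ=12: L=48: 0.3747  72: 0.4054  96: 0.4165  144: 0.4246  192: 0.4274  288: 0.4295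
  m=12 ℓ=6 : L=48: 0.6770  72: 0.6934  96: 0.6992  144: 0.7034  192: 0.7049  288: 0.7059
  m=24 ℓ=24: L=96: 0.4083  144: 0.4387  192: 0.4495  288: 0.4573
  m=24 ℓ=12: L=96: 0.7267  144: 0.7411  192: 0.7462  288: 0.7498
  m=48 ℓ=48: L=192: 0.4266  288: 0.4567
  m=48 ℓ=24: L=192: 0.7521  288: 0.7654
(j008794, `ℓ = m`: m=6,L=36: 0.3478; m=8,L=32: 0.3444; m=8,L=48: 0.3752; m=12,L=72: 0.4054.)
STEP 1 (finite box): `R(L) = R_∞(m,ℓ) − c/L^p` with fitted `p = 1.97, 1.97, 1.99, 1.96` (the four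
series with ≥ 2 doublings) — the CFT `(m/L)²` correction from the far free sides, `c/m² ≈ 0.9`
(`ℓ = m`), `≈ 0.45` (`ℓ = m/2`) independently of `m`; extrapolated
`R_∞(m, m)   = 0.431 (m=12), 0.464 (24), 0.481 (48)`,
`R_∞(m, m/2) = 0.707 (m=12), 0.753 (24), 0.776 (48)`.
STEP 2 (lattice → continuum): `R_∞(m) = R* − a/m` fits both steps (`12→24`, `24→48`) to `±0.002`:
`ℓ = m`:   `R* = 0.498` (from 24, 48; `0.496` from 12, 24)  — prediction `0.500`;
`ℓ = m/2`: `R* = 0.7995` (from 24, 48; `0.799` from 12, 24) — prediction `0.800`.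
As an exponent: `h_eff = log R*/(2 log(m²/(m²+ℓ²))) = 0.503` (`ℓ = m`), `0.501` (`ℓ = m/2`).
Also `⟨σ_{-m}σ_m⟩_box·m = 0.367` for m = 6, 8, 12 (j008794): the boundary decay `η_∥ = 1 = 2h`.

VERDICT OF THE NUMERICS: value AND shape of the crux's law — the free-boundary spin is a weight-½
boundary primary transforming covariantly under the hull map, ratio `→ Φ'`-law with exponent `½`
— are confirmed to `≈ 1%` (`h = 0.50 ± 0.01`) on `ℤ²` at `β_c = ½ log(1+√2)`, in a geometry that
is a genuine instance of the crux up to the position of the second marked point (finite `b`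
instead of the chordal `b = ∞`; the covariance law tested is the same). No kill; the numerics
join the proved diagonal (§6) and the GKS range (§3) as positive evidence. (Job `j009318`, a
coarser scan, was cancelled as superseded.)
-/

end Summit.CriticalPhenomena.SAWScalingLimit.Cruxes.IsingBoundaryRatio.Disproof
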